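import Literature.Geometry.Symplectic.OrigamiCutSpace
import Literature.Geometry.Symplectic.OrigamiCutFormBasic
import Literature.Geometry.Manifold.InjOnLocalDiffeomorphInverse
import HarnessLib

/-!
# The real slice `(n, t) ↦ [n, t]` of the cut space is a diffeomorphism of `N × (0, ∞)` onto the
# complement of the zero section

Proofs companion of `OrigamiUnfolding.lean` (the named fact
`Literature.Geometry.Symplectic.exists_symplecticCutPieces_of_isOrigamiForm`, Cannas da
Silva–Guillemin–Pires, *Symplectic Origami*, IMRN 2011 = arXiv:0909.4065, Prop. 2.8), step (S3):
in the proof of Prop. 2.8 the collar `𝒰⁺ ≅ Z × (0, ε)` is identified with the complement of the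
centre in the cut piece by `j⁺(φ(x, s)) = [x, s, √(2s)]`; in the tree's coordinates this is the
REAL SLICE `cutSlice (n, t) = [n, t]` of the cut space `CutSpace k N = ProdC k N / S¹`
(`OrigamiCutSpace.lean`), i.e. the orbit map composed with `realSlice` (`OrigamiCutFormBasic.lean`).
This file proves that it is a diffeomorphism of `N × (0, ∞)` onto `{|w|² ≠ 0}`:

* `cutSlice`, `cutSlice_apply`, `contMDiff_cutSlice`, `cutNormSq_cutSlice` (`= t²`);
* `injOn_cutSlice` — injective on `t > 0` (`[n, t] = [n', t']` forces the group element to be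
  the positive real unit `t/t' = 1`);
* `bijective_mfderiv_cutSlice` — bijective differential for `t ≠ 0` (`dπ ∘ d(realSlice)` kills
  `(a, σ)` only if `L (a, σ)` is a multiple of the generator `L (X, it)`, impossible for real
  `σ` unless `(a, σ) = 0`; bijectivity by equality of dimensions);
* `image_cutSlice_pos` — `cutSlice '' (N × (0, ∞)) = {|w|² ≠ 0}`, and the bounded version
  `image_cutSlice_Ioo`;
* `cutUnslice := invFunOn cutSlice (N × (0, ∞))` — the smooth inverse on the complement of the
  zero section (`contMDiffOn_cutUnslice`, `cutUnslice_cutSlice`, `cutSlice_cutUnslice`,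
  `cutUnslice_mem`, `cutUnslice_snd_eq` : its `ℝ`-component is `√|w|²`).

Everything here is proved; the definitions are explicit; no facts.

## References

* A. Cannas da Silva, V. Guillemin, A. R. Pires, *Symplectic Origami*, IMRN 2011 =
  arXiv:0909.4065, proofs of Prop. 2.8 and Prop. 2.26. [CannasdasilvaGuilleminPires2010]
-/

noncomputable section

open scoped Manifold ContDiff Topology
open Set Function Filter TopologicalSpace
open Literature.Geometry.Kaehler Literature.Geometry.Manifold

namespace Literature.Geometry.Symplectic

variable {k : ℕ} {N : Type*} [TopologicalSpace N] [ChartedSpace (EuclideanSpace ℝ (Fin k)) N]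
  [IsManifold (𝓡 k) ∞ N] [T2Space N] [MulAction Circle N]
  (hθ : ContMDiff ((𝓡 1).prod (𝓡 k)) (𝓡 k) ∞ (fun x : Circle × N => x.1 • x.2))
  (hfree : ∀ (a : Circle) (x : N), a • x = x → a = 1)

/-! ### The real slice of the cut space -/

/-- **The real slice of the cut space**: `(n, t) ↦ [n, t]`. [cite: CannasdasilvaGuilleminPires2010, Prop. 2.8] -/
def cutSlice (q : N × ℝ) : CutSpace k N := circleQuotientMk (realSlice k N q)

omit [IsManifold (𝓡 k) ∞ N] [T2Space N] in
/-- `cutSlice (n, t) = [n, t]`. [folklore] -/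
theorem cutSlice_apply (n : N) (t : ℝ) : cutSlice (k := k) (n, t) = cutMk n (t : ℂ) := rfl

omit [IsManifold (𝓡 k) ∞ N] [T2Space N] in
/-- `cutSlice = π ∘ realSlice`. [folklore] -/
theorem cutSlice_eq_comp : (cutSlice : N × ℝ → CutSpace k N) =
    (circleQuotientMk : ProdC k N → CutSpace k N) ∘ realSlice k N := rfl

omit [IsManifold (𝓡 k) ∞ N] [T2Space N] in
/-- `|w|²` along the slice is `t²`. [folklore] -/
@[simp] theorem cutNormSq_cutSlice (n : N) (t : ℝ) : cutNormSq (cutSlice (k := k) (n, t)) = t ^ 2 := by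
  rw [cutSlice_apply, cutNormSq_cutMk, Complex.norm_real, Real.norm_eq_abs, sq_abs]

/-- The real slice is `C^∞`. [folklore] -/
theorem contMDiff_cutSlice :
    letI := cutChartedSpace hθ hfree
    ContMDiff ((𝓡 k).prod 𝓘(ℝ, ℝ)) (𝓡 (k + 1)) ∞ (cutSlice : N × ℝ → CutSpace k N) := by
  letI := cutChartedSpace hθ hfree
  exact (contMDiff_circleQuotientMk_prodC hθ hfree).comp contMDiff_realSlice

omit [IsManifold (𝓡 k) ∞ N] [T2Space N] in
/-- The real slice is continuous. [folklore] -/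
theorem continuous_cutSlice : Continuous (cutSlice : N × ℝ → CutSpace k N) :=
  continuous_circleQuotientMk.comp (ProdC.continuous_mkUncurry.comp
    (continuous_fst.prodMk (Complex.continuous_ofReal.comp continuous_snd)))

omit [IsManifold (𝓡 k) ∞ N] [T2Space N] in
/-- A unit complex number which is a positive real is `1`. [folklore] -/
theorem circle_eq_one_of_mul_ofReal {a : Circle} {t t' : ℝ} (ht : 0 < t) (ht' : 0 < t')
    (h : (a : ℂ) * (t' : ℂ) = (t : ℂ)) : a = 1 := by
  have ha : (a : ℂ) = ((t / t' : ℝ) : ℂ) := by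
    rw [Complex.ofReal_div, eq_div_iff (Complex.ofReal_ne_zero.2 ht'.ne'), h]
  have hn : ‖(a : ℂ)‖ = 1 := Circle.norm_coe a
  rw [ha, Complex.norm_real, Real.norm_eq_abs, abs_of_pos (div_pos ht ht')] at hn
  have h1 : (a : ℂ) = 1 := by rw [ha, hn, Complex.ofReal_one]
  exact Circle.coe_injective (by simpa using h1)

omit [IsManifold (𝓡 k) ∞ N] [T2Space N] in
/-- **The real slice is injective on `t > 0`.** [cite: CannasdasilvaGuilleminPires2010, Prop. 2.8] -/
theorem injOn_cutSlice : InjOn (cutSlice : N × ℝ → CutSpace k N) (univ ×ˢ Ioi 0) := by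
  rintro ⟨n, t⟩ ⟨-, ht⟩ ⟨n', t'⟩ ⟨-, ht'⟩ h
  rw [cutSlice_apply, cutSlice_apply, cutMk_eq_cutMk_iff] at h
  obtain ⟨a, han, hat⟩ := h
  have ha : a = 1 := circle_eq_one_of_mul_ofReal ht ht' hat
  subst ha
  rw [one_smul] at han
  rw [Circle.coe_one, one_mul, Complex.ofReal_inj] at hat
  rw [han, hat]

omit [IsManifold (𝓡 k) ∞ N] [T2Space N] in
/-- **The image of `N × (0, ∞)` under the slice is the complement of the zero section.**
[cite: CannasdasilvaGuilleminPires2010, Prop. 2.8] -/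
theorem image_cutSlice_pos :
    (cutSlice : N × ℝ → CutSpace k N) '' (univ ×ˢ Ioi 0) = {q | cutNormSq q ≠ 0} := by
  ext q
  constructor
  · rintro ⟨⟨n, t⟩, ⟨-, ht⟩, rfl⟩
    rw [mem_setOf_eq, cutNormSq_cutSlice]
    exact pow_ne_zero 2 (ne_of_gt ht)
  · intro hq
    obtain ⟨n, w, rfl⟩ := cutMk_surjective q
    rw [mem_setOf_eq, cutNormSq_cutMk] at hq
    have hw : w ≠ 0 := by
      intro h; apply hq; rw [h, norm_zero, zero_pow two_ne_zero]
    have hnw : (‖w‖ : ℂ) ≠ 0 := Complex.ofReal_ne_zero.2 (norm_ne_zero_iff.2 hw)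
    -- the unit `u = w / |w|`
    let u : Circle := ⟨w / ‖w‖, mem_sphere_zero_iff_norm.2 (by
      rw [norm_div, Complex.norm_real, Real.norm_eq_abs, abs_norm, div_self (norm_ne_zero_iff.2 hw)])⟩
    refine ⟨(u⁻¹ • n, ‖w‖), ⟨mem_univ _, norm_pos_iff.2 hw⟩, ?_⟩
    rw [cutSlice_apply, cutMk_eq_cutMk_iff]
    refine ⟨u⁻¹, rfl, ?_⟩
    rw [Circle.coe_inv]
    show (w / ‖w‖)⁻¹ * w = ‖w‖
    rw [inv_div, div_mul_cancel₀ _ hw]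

omit [IsManifold (𝓡 k) ∞ N] [T2Space N] in
/-- Bounded version: `cutSlice '' (N × (0, δ)) = {0 < |w|² < δ²}` for `δ > 0`. [folklore] -/
theorem image_cutSlice_Ioo {δ : ℝ} (hδ : 0 < δ) :
    (cutSlice : N × ℝ → CutSpace k N) '' (univ ×ˢ Ioo 0 δ) =
      {q | cutNormSq q ≠ 0 ∧ cutNormSq q < δ ^ 2} := by
  ext q
  constructor
  · rintro ⟨⟨n, t⟩, ⟨-, ht⟩, rfl⟩
    rw [mem_setOf_eq, cutNormSq_cutSlice]
    exact ⟨pow_ne_zero 2 (ne_of_gt ht.1), pow_lt_pow_left₀ ht.2 ht.1.le two_ne_zero⟩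
  · rintro ⟨hq0, hqδ⟩
    have hq : q ∈ (cutSlice : N × ℝ → CutSpace k N) '' (univ ×ˢ Ioi 0) := by
      rw [image_cutSlice_pos]; exact hq0
    obtain ⟨⟨n, t⟩, ⟨-, ht⟩, rfl⟩ := hq
    rw [cutNormSq_cutSlice] at hqδ
    refine ⟨(n, t), ⟨mem_univ _, ht, ?_⟩, rfl⟩
    exact lt_of_pow_lt_pow_left₀ 2 hδ.le hqδ

/-! ### The differential of the slice -/

/-- **The differential of the real slice is bijective off `t = 0`.**
[cite: CannasdasilvaGuilleminPires2010, Prop. 2.8] -/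
theorem bijective_mfderiv_cutSlice (n : N) {t : ℝ} (ht : t ≠ 0) :
    letI := cutChartedSpace hθ hfree
    Bijective (mfderiv ((𝓡 k).prod 𝓘(ℝ, ℝ)) (𝓡 (k + 1)) (cutSlice : N × ℝ → CutSpace k N) (n, t)) := by
  letI := cutChartedSpace hθ hfree
  haveI := isManifold_cutSpace hθ hfree
  -- chain rule
  have hπ : MDifferentiableAt (𝓡 (k + 2)) (𝓡 (k + 1))
      (circleQuotientMk : ProdC k N → CutSpace k N) (realSlice k N (n, t)) :=
    ((contMDiff_circleQuotientMk_prodC hθ hfree) _).mdifferentiableAt (by simp)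
  have hR : MDifferentiableAt ((𝓡 k).prod 𝓘(ℝ, ℝ)) (𝓡 (k + 2)) (realSlice k N) (n, t) :=
    (contMDiff_realSlice (k := k) (N := N) (n, t)).mdifferentiableAt (by simp)
  have hcomp : mfderiv ((𝓡 k).prod 𝓘(ℝ, ℝ)) (𝓡 (k + 1)) (cutSlice : N × ℝ → CutSpace k N) (n, t) =
      (mfderiv (𝓡 (k + 2)) (𝓡 (k + 1)) (circleQuotientMk : ProdC k N → CutSpace k N)
        (realSlice k N (n, t))).comp
        (mfderiv ((𝓡 k).prod 𝓘(ℝ, ℝ)) (𝓡 (k + 2)) (realSlice k N) (n, t)) := by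
    rw [cutSlice_eq_comp]; exact mfderiv_comp _ hπ hR
  -- injectivity
  have hinj : Injective (mfderiv ((𝓡 k).prod 𝓘(ℝ, ℝ)) (𝓡 (k + 1))
      (cutSlice : N × ℝ → CutSpace k N) (n, t)) := by
    rw [hcomp]
    intro V₁ V₂ hV
    obtain ⟨a₁, σ₁⟩ := V₁
    obtain ⟨a₂, σ₂⟩ := V₂
    have hV' : mfderiv (𝓡 (k + 2)) (𝓡 (k + 1)) (circleQuotientMk : ProdC k N → CutSpace k N)
        (realSlice k N (n, t))
        (mfderiv ((𝓡 k).prod 𝓘(ℝ, ℝ)) (𝓡 (k + 2)) (realSlice k N) (n, t)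
          (((a₁, σ₁) : EuclideanSpace ℝ (Fin k) × ℝ))) =
      mfderiv (𝓡 (k + 2)) (𝓡 (k + 1)) (circleQuotientMk : ProdC k N → CutSpace k N)
        (realSlice k N (n, t))
        (mfderiv ((𝓡 k).prod 𝓘(ℝ, ℝ)) (𝓡 (k + 2)) (realSlice k N) (n, t)
          (((a₂, σ₂) : EuclideanSpace ℝ (Fin k) × ℝ))) := hV
    rw [mfderiv_realSlice_apply, mfderiv_realSlice_apply] at hV'
    -- `dπ (L (a₁ - a₂, σ₁ - σ₂)) = 0`
    have h0 : mfderiv (𝓡 (k + 2)) (𝓡 (k + 1)) (circleQuotientMk : ProdC k N → CutSpace k N)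
        (realSlice k N (n, t)) (ProdC.tangentLift k (a₁ - a₂) ((σ₁ : ℂ) - (σ₂ : ℂ))) = 0 := by
      rw [show ProdC.tangentLift k (a₁ - a₂) ((σ₁ : ℂ) - (σ₂ : ℂ)) =
          ProdC.tangentLift k a₁ (σ₁ : ℂ) - ProdC.tangentLift k a₂ (σ₂ : ℂ) by
        rw [ProdC.tangentLift_eq, ProdC.tangentLift_eq, ProdC.tangentLift_eq, ← map_sub,
          Prod.mk_sub_mk]]
      exact (map_sub _ _ _).trans (sub_eq_zero.2 hV')
    obtain ⟨c, hc⟩ := exists_smul_of_mfderiv_circleQuotientMk_eq_zero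
      (ProdC.contMDiff_smul_prodC hθ) (ProdC.smul_eq_self_prodC hfree)
      (show Module.finrank ℝ (EuclideanSpace ℝ (Fin (k + 1))) + 1 = k + 2 by rw [finrank_euclideanSpace_fin]) (realSlice k N (n, t)) _ h0
    rw [circleFundVec_eq, show realSlice k N (n, t) = ProdC.mk n (t : ℂ) from rfl,
      ProdC.mfderiv_circleOrbit_prodC hθ] at hc
    -- compare the `ℂ`-components: `σ₁ - σ₂ = c • (i t)` is real and imaginary, hence `c = 0`
    have h2 := congrArg (mfderiv (𝓡 (k + 2)) 𝓘(ℝ, ℂ) ProdC.snd (ProdC.mk n (t : ℂ) : ProdC k N)) hc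
    rw [map_smul, ProdC.mfderiv_snd_tangentLift, ProdC.mfderiv_snd_tangentLift] at h2
    have h2' : ((σ₁ : ℂ) - (σ₂ : ℂ)) = (c : ℂ) * (Complex.I * (t : ℂ)) := h2.trans Complex.real_smul
    have h2im := congrArg Complex.im h2'
    simp only [Complex.sub_im, Complex.ofReal_im, sub_zero, Complex.mul_im, Complex.ofReal_re,
      Complex.I_re, Complex.I_im, zero_mul, mul_zero, one_mul, zero_add, add_zero] at h2im
    have hc0 : c = 0 := by
      rcases mul_eq_zero.1 h2im.symm with h | h
      · exact h
      · exact absurd h ht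
    rw [hc0, zero_smul] at hc
    have h3 := (ProdC.tangentLift_eq_zero_iff (k := k)).1 hc
    have ha : a₁ = a₂ := sub_eq_zero.1 h3.1
    have hσ : σ₁ = σ₂ := by
      have := h3.2
      rwa [sub_eq_zero, Complex.ofReal_inj] at this
    rw [ha, hσ]
  -- bijectivity from the dimensions
  refine ⟨hinj, ?_⟩
  haveI : FiniteDimensional ℝ (TangentSpace ((𝓡 k).prod 𝓘(ℝ, ℝ)) ((n, t) : N × ℝ)) :=
    inferInstanceAs (FiniteDimensional ℝ (EuclideanSpace ℝ (Fin k) × ℝ))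
  haveI : FiniteDimensional ℝ (TangentSpace (𝓡 (k + 1)) (cutSlice (k := k) (n, t))) :=
    inferInstanceAs (FiniteDimensional ℝ (EuclideanSpace ℝ (Fin (k + 1))))
  have hdim : Module.finrank ℝ (TangentSpace ((𝓡 k).prod 𝓘(ℝ, ℝ)) ((n, t) : N × ℝ)) =
      Module.finrank ℝ (TangentSpace (𝓡 (k + 1)) (cutSlice (k := k) (n, t))) := by
    show Module.finrank ℝ (EuclideanSpace ℝ (Fin k) × ℝ) = Module.finrank ℝ (EuclideanSpace ℝ (Fin (k + 1)))
    rw [Module.finrank_prod, finrank_euclideanSpace_fin, finrank_euclideanSpace_fin, Module.finrank_self]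
  exact (LinearMap.injective_iff_surjective_of_finrank_eq_finrank hdim
    (f := (mfderiv ((𝓡 k).prod 𝓘(ℝ, ℝ)) (𝓡 (k + 1)) (cutSlice : N × ℝ → CutSpace k N) (n, t)).toLinearMap)).1
    hinj

/-! ### The inverse of the slice off the zero section -/

/-- **The inverse of the real slice** on the complement of the zero section (junk on it).
[cite: CannasdasilvaGuilleminPires2010, Prop. 2.8] -/
def cutUnslice [Nonempty N] : CutSpace k N → N × ℝ := invFunOn (cutSlice : N × ℝ → CutSpace k N) (univ ×ˢ Ioi 0)

omit [IsManifold (𝓡 k) ∞ N] [T2Space N] in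
/-- `cutUnslice q ∈ N × (0, ∞)` off the zero section. [folklore] -/
theorem cutUnslice_mem [Nonempty N] {q : CutSpace k N} (hq : cutNormSq q ≠ 0) :
    cutUnslice q ∈ (univ ×ˢ Ioi 0 : Set (N × ℝ)) := by
  have hq' : q ∈ (cutSlice : N × ℝ → CutSpace k N) '' (univ ×ˢ Ioi 0) := by
    rw [image_cutSlice_pos]; exact hq
  exact Literature.Geometry.Manifold.invFunOn_mem hq'

omit [IsManifold (𝓡 k) ∞ N] [T2Space N] in
/-- `cutSlice (cutUnslice q) = q` off the zero section. [folklore] -/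
theorem cutSlice_cutUnslice [Nonempty N] {q : CutSpace k N} (hq : cutNormSq q ≠ 0) :
    cutSlice (cutUnslice q) = q := by
  have hq' : q ∈ (cutSlice : N × ℝ → CutSpace k N) '' (univ ×ˢ Ioi 0) := by
    rw [image_cutSlice_pos]; exact hq
  exact apply_invFunOn hq'

omit [IsManifold (𝓡 k) ∞ N] [T2Space N] in
/-- `cutUnslice [n, t] = (n, t)` for `t > 0`. [folklore] -/
theorem cutUnslice_cutSlice [Nonempty N] (n : N) {t : ℝ} (ht : 0 < t) :
    cutUnslice (cutSlice (k := k) (n, t)) = (n, t) :=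
  invFunOn_apply (injOn_cutSlice) (x := (n, t)) ⟨mem_univ _, ht⟩

omit [IsManifold (𝓡 k) ∞ N] [T2Space N] in
/-- The `ℝ`-component of the inverse slice is `√|w|²`. [folklore] -/
theorem cutUnslice_snd_sq [Nonempty N] {q : CutSpace k N} (hq : cutNormSq q ≠ 0) :
    (cutUnslice q).2 ^ 2 = cutNormSq q ∧ 0 < (cutUnslice q).2 := by
  have hmem := cutUnslice_mem (k := k) hq
  have h := cutSlice_cutUnslice (k := k) hq
  refine ⟨?_, hmem.2⟩
  conv_rhs => rw [← h]
  rw [show cutUnslice q = ((cutUnslice q).1, (cutUnslice q).2) from rfl, cutNormSq_cutSlice]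

/-- **The inverse slice is `C^∞` off the zero section** (inverse function theorem: the slice is
injective with bijective differential on the open set `N × (0, ∞)`).
[cite: CannasdasilvaGuilleminPires2010, Prop. 2.8] -/
theorem contMDiffOn_cutUnslice [Nonempty N] :
    letI := cutChartedSpace hθ hfree
    ContMDiffOn (𝓡 (k + 1)) ((𝓡 k).prod 𝓘(ℝ, ℝ)) ∞ (cutUnslice : CutSpace k N → N × ℝ)
      {q | cutNormSq q ≠ 0} := by
  letI := cutChartedSpace hθ hfree
  haveI := isManifold_cutSpace hθ hfree
  rw [← image_cutSlice_pos]
  exact contMDiffOn_invFunOn_of_bijective_mfderiv (isOpen_univ.prod isOpen_Ioi)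
    (contMDiff_cutSlice hθ hfree).contMDiffOn (injOn_cutSlice)
    fun x hx => bijective_mfderiv_cutSlice hθ hfree x.1 (ne_of_gt hx.2)

/-- `d(cutSlice) ∘ d(cutUnslice) = id` off the zero section. [folklore] -/
theorem mfderiv_cutSlice_mfderiv_cutUnslice [Nonempty N] (n : N) {t : ℝ} (ht : 0 < t)
    (u : letI := cutChartedSpace hθ hfree
      TangentSpace (𝓡 (k + 1)) (cutSlice (k := k) (n, t))) :
    letI := cutChartedSpace hθ hfree
    mfderiv ((𝓡 k).prod 𝓘(ℝ, ℝ)) (𝓡 (k + 1)) (cutSlice : N × ℝ → CutSpace k N) (n, t)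
      (mfderiv (𝓡 (k + 1)) ((𝓡 k).prod 𝓘(ℝ, ℝ)) (cutUnslice : CutSpace k N → N × ℝ)
        (cutSlice (k := k) (n, t)) u) = u := by
  letI := cutChartedSpace hθ hfree
  haveI := isManifold_cutSpace hθ hfree
  exact mfderiv_comp_mfderiv_invFunOn (isOpen_univ.prod isOpen_Ioi)
    (contMDiff_cutSlice hθ hfree).contMDiffOn (injOn_cutSlice)
    (fun x hx => bijective_mfderiv_cutSlice hθ hfree x.1 (ne_of_gt hx.2)) (x := (n, t))
    ⟨mem_univ _, ht⟩ u

end Literature.Geometry.Symplectic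

end
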